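import Summits.QuantumFields.YangMills.Theorems.BalabanLadderIRTwistedSlabRepSandwich
import Summits.QuantumFields.YangMills.Theorems.BalabanLadderIRTwistedSlabTreeLevelUniform
import HarnessLib

/-!
# K36 FOR EVERY FAITHFUL LATTICE REPRESENTATION `r` OF `SU(N)` (modulo the one-plaquette Hessian ratio (Q)): the `β → ∞` limit of
# `projSlabDefect r.ρ` EXISTS, EQUALS the defining representation's, and obeys K36's `L`-uniform bound — the Dynkin index CANCELS

HELPER toward stub **T1** `TwistedSlabAnchor` (LINE `twisted-slab-continuity`, crux `IRcof` stmt-QuantumFields-26930, census row 43; pooled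
prover ym-ir-line-pool-p3 g17 on director KEY №56 «r-port as ONE rescaling statement»; `--supports` the crux, `--as helper`).  Theorems only.
Sequel of `…RepSandwich` (p702041: the ONE r-dependent statement K23 rescaled, `β^{a}·W{r.ρ}(β) → κ^{−a}·C`):
* §1 `tendsto_projSlabZ_div_twistedPartition_rep` — TreeLevelDefect §3 for ANY faithful continuous unitary `ρ` on `SU(N)` (g0's ratio lemma is
  already ρ-generic): `projSlabZ(ρ; β) ∕ W{ρ; ω^k, 1}(β) → q = n⁻¹·#{j < n : z^j = 1} > 0`;
* §2 `tendsto_projSlabDefect_of_tendsto` — TreeLevelDefect §4's algebra, ρ-generic: `β^{a}W(t) → C₁ > 0`, `β^{2a}W(2t) → C₂`, projection ratios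
  `→ q > 0` ⇒ `projSlabDefect(ρ) → 1 − C₂ ∕ (q·C₁²)`;
* §3 ★ `treeLevel_uniform_rep` — K36's shape for `r.ρ` with K36's OWN `(c, C)`: the limit exists and equals the defining representation's
  (`κ^{−2a}C₂ ∕ (q·(κ^{−a}C₁)²) = C₂ ∕ (q·C₁²)`), hence `D ≤ C·L·e^{−ct}`.  The threshold form (K38∕K39 for `r`) is the companion `…RepThreshold`.
HONEST FRAMING: binder coverage in `r` MODULO (Q) (classical: `κ` = Dynkin-index ratio by Schur on the simple `𝔰𝔲(N)`; not in the tree); M4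
(`∀L∃β₀ → ∃β₀∀L`) and general `G` (BFM) untouched; T1 0∕1; `IRcof` ∕ `IR` 0∕1; the Yang–Mills mass gap (Clay) is NOT proved; R4 = `BalabanLadder.UV`
only.  References: 't Hooft, NPB 153 (1979) §5; García Pérez–González-Arroyo–Okawa, IJMPA 29 (2014) 1445001 §3.
-/

set_option autoImplicit false

noncomputable section

open scoped BigOperators Topology Matrix.Norms.L2Operator
open Finset Filter Module
open Literature.MathematicalPhysics.QuantumFieldTheory Literature.MathematicalPhysics.QuantumLattice
open Literature.MathematicalPhysics.QuantumFieldTheory.Balaban1983to89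
open Literature.Barriers.QuantumFields (re_trace_le_of_mem_unitaryGroup eq_one_of_re_trace_eq)

namespace Summit.QuantumFields.YangMills.Cruxes.IRcof.TwistedSlab

/-! ## §1 The `e₂`-projection in the classical limit, any faithful continuous unitary `ρ` -/

section Projection

variable {N : ℕ} [NeZero N] {M : ℕ} {ρ : Matrix.specialUnitaryGroup (Fin N) ℂ →* Matrix (Fin M) (Fin M) ℂ} {m₀ m₂ m₃ : ℕ}

/-- **The e₂-projection in the classical limit, any faithful continuous unitary `ρ`**: `projSlabZ(ρ; β) ∕ W{ρ; ω^k·1, 1}(β) ⟶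
q := n⁻¹·#{j < n : (ω^k·1)^j = 1} > 0` (the summands with `z^j ≠ 1` are exponentially smaller, g0 `tendsto_twistRatio_zero_specialUnitary`).
[cite: tHooft1979Flux, §5 (5.2)–(5.4)] -/
theorem tendsto_projSlabZ_div_twistedPartition_rep {k : ZMod N} (hk : IsUnit k) {n : ℕ} (hn : 0 < n) (hρ : Continuous ρ)
    (hρu : ∀ g, ρ g ∈ Matrix.unitaryGroup (Fin M) ℂ) (hinj : Function.Injective ρ) :
    Tendsto (fun β : ℝ => projSlabZ ρ β (suCenter N k : Matrix.specialUnitaryGroup (Fin N) ℂ) n (m₀ + 1) (m₂ + 1) (m₃ + 1) /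
        wilsonFinTorusTensorTwistedPartition ρ β (slabTwist (suCenter N k : Matrix.specialUnitaryGroup (Fin N) ℂ) 1) (m₀ + 1) (m₀ + 1) (m₂ + 1) (m₃ + 1)) atTop
      (𝓝 ((n : ℝ)⁻¹ * ((Finset.univ.filter fun j : Fin n => (suCenter N k : Matrix.specialUnitaryGroup (Fin N) ℂ) ^ (j : ℕ) = 1).card : ℝ))) ∧
    0 < (n : ℝ)⁻¹ * ((Finset.univ.filter fun j : Fin n => (suCenter N k : Matrix.specialUnitaryGroup (Fin N) ℂ) ^ (j : ℕ) = 1).card : ℝ) := by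
  classical
  set z := (suCenter N k : Matrix.specialUnitaryGroup (Fin N) ℂ) with hz
  set W₁ : ℝ → ℝ := fun β => wilsonFinTorusTensorTwistedPartition ρ β (slabTwist z 1) (m₀ + 1) (m₀ + 1) (m₂ + 1) (m₃ + 1) with hW₁
  have hW₁pos : ∀ β, 0 < W₁ β := fun β => wilsonFinTorusTensorTwistedPartition_pos _ hρ β _ _ _ _ _
  have hterm : ∀ j : Fin n, Tendsto (fun β : ℝ => wilsonFinTorusTensorTwistedPartition ρ β (slabTwist z (z ^ (j : ℕ)))
      (m₀ + 1) (m₀ + 1) (m₂ + 1) (m₃ + 1) / W₁ β) atTop (𝓝 (if z ^ (j : ℕ) = 1 then 1 else 0)) := by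
    intro j
    by_cases hj : z ^ (j : ℕ) = 1
    · rw [if_pos hj, hj]
      exact tendsto_const_nhds.congr' (Eventually.of_forall fun β => (div_self (hW₁pos β).ne').symm)
    · rw [if_neg hj]
      exact tendsto_twistRatio_zero_specialUnitary hk (Subgroup.pow_mem _ (suCenter N k).2 _) hj hρ hρu hinj
  have hsum := tendsto_finsetSum Finset.univ fun j _ => hterm j
  have hq : (∑ j : Fin n, (if z ^ (j : ℕ) = 1 then (1 : ℝ) else 0)) =
      ((Finset.univ.filter fun j : Fin n => z ^ (j : ℕ) = 1).card : ℝ) := by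
    rw [Finset.sum_ite, Finset.sum_const_zero, add_zero, Finset.sum_const, nsmul_eq_mul, mul_one]
  refine ⟨?_, ?_⟩
  · have h := hsum.const_mul (n : ℝ)⁻¹
    rw [hq] at h
    refine h.congr' (Eventually.of_forall fun β => ?_)
    simp only [projSlabZ, hW₁]
    rw [mul_div_assoc, Finset.sum_div]
  · have hcard : 0 < (Finset.univ.filter fun j : Fin n => z ^ (j : ℕ) = 1).card :=
      Finset.card_pos.2 ⟨⟨0, hn⟩, Finset.mem_filter.2 ⟨Finset.mem_univ _, by simp⟩⟩
    have hn' : (0 : ℝ) < n := by exact_mod_cast hn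
    positivity

end Projection

/-! ## §2 The defect limit from the two Laplace constants and the projection weight (ρ-generic algebra) -/

section Algebra

variable {N : ℕ} {M : ℕ} {ρ : Matrix.specialUnitaryGroup (Fin N) ℂ →* Matrix (Fin M) (Fin M) ℂ} {m m₂ m₃ : ℕ}

/-- **The classical defect limit from its ingredients** (ρ-generic): if `β^{a}·W{ρ}(β; t-box) → C₁ > 0`, `β^{a₂}·W{ρ}(β; 2t-box) → C₂` with
`a₂ = 2a`, and both projection ratios tend to `q > 0`, then `projSlabDefect ρ → 1 − C₂ ∕ (q·C₁²)`. [cite: tHooft1979Flux, §5] -/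
theorem tendsto_projSlabDefect_of_tendsto (hρ : Continuous ρ) {z : Matrix.specialUnitaryGroup (Fin N) ℂ} {n : ℕ} {a a₂ C₁ C₂ q : ℝ}
    (haa : a₂ = 2 * a) (hC₁ : 0 < C₁) (hq : 0 < q)
    (h₁ : Tendsto (fun β : ℝ => β ^ a * wilsonFinTorusTensorTwistedPartition ρ β (slabTwist z 1) (m + 1) (m + 1) (m₂ + 1) (m₃ + 1))
      atTop (𝓝 C₁))
    (h₂ : Tendsto (fun β : ℝ => β ^ a₂ * wilsonFinTorusTensorTwistedPartition ρ β (slabTwist z 1) (m + 1) (m + 1) (m₂ + 1) (2 * m₃ + 1 + 1))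
      atTop (𝓝 C₂))
    (hq₁ : Tendsto (fun β : ℝ => projSlabZ ρ β z n (m + 1) (m₂ + 1) (m₃ + 1) /
      wilsonFinTorusTensorTwistedPartition ρ β (slabTwist z 1) (m + 1) (m + 1) (m₂ + 1) (m₃ + 1)) atTop (𝓝 q))
    (hq₂ : Tendsto (fun β : ℝ => projSlabZ ρ β z n (m + 1) (m₂ + 1) (2 * m₃ + 1 + 1) /
      wilsonFinTorusTensorTwistedPartition ρ β (slabTwist z 1) (m + 1) (m + 1) (m₂ + 1) (2 * m₃ + 1 + 1)) atTop (𝓝 q)) :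
    Tendsto (fun β : ℝ => projSlabDefect ρ β z n (m + 1) (m₂ + 1) (m₃ + 1)) atTop (𝓝 (1 - C₂ / (q * C₁ ^ 2))) := by
  set W₁ : ℝ → ℝ := fun β => wilsonFinTorusTensorTwistedPartition ρ β (slabTwist z 1) (m + 1) (m + 1) (m₂ + 1) (m₃ + 1) with hW₁
  set W₂ : ℝ → ℝ := fun β => wilsonFinTorusTensorTwistedPartition ρ β (slabTwist z 1) (m + 1) (m + 1) (m₂ + 1) (2 * m₃ + 1 + 1) with hW₂
  set P₁ : ℝ → ℝ := fun β => projSlabZ ρ β z n (m + 1) (m₂ + 1) (m₃ + 1) with hP₁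
  set P₂ : ℝ → ℝ := fun β => projSlabZ ρ β z n (m + 1) (m₂ + 1) (2 * m₃ + 1 + 1) with hP₂
  have hW₁pos : ∀ β, 0 < W₁ β := fun β => wilsonFinTorusTensorTwistedPartition_pos _ hρ β _ _ _ _ _
  have hW₂pos : ∀ β, 0 < W₂ β := fun β => wilsonFinTorusTensorTwistedPartition_pos _ hρ β _ _ _ _ _
  have hkey : ∀ β : ℝ, 0 < β → P₂ β / P₁ β ^ 2 = (β ^ a₂ * W₂ β) * (P₂ β / W₂ β) / ((β ^ a * W₁ β) * (P₁ β / W₁ β)) ^ 2 := by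
    intro β hβ
    have hβa : β ^ a₂ = (β ^ a) ^ 2 := by rw [haa, mul_comm, Real.rpow_mul hβ.le, Real.rpow_two]
    have h1 : (β ^ a) ≠ 0 := (Real.rpow_pos_of_pos hβ a).ne'
    have h2 : W₁ β ≠ 0 := (hW₁pos β).ne'
    have h3 : W₂ β ≠ 0 := (hW₂pos β).ne'
    rw [hβa]
    field_simp
  have hlim : Tendsto (fun β : ℝ => (β ^ a₂ * W₂ β) * (P₂ β / W₂ β) / ((β ^ a * W₁ β) * (P₁ β / W₁ β)) ^ 2) atTop
      (𝓝 (C₂ * q / (C₁ * q) ^ 2)) :=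
    (h₂.mul hq₂).div ((h₁.mul hq₁).pow 2) (by positivity)
  have hval : C₂ * q / (C₁ * q) ^ 2 = C₂ / (q * C₁ ^ 2) := by
    field_simp
  have hratio : Tendsto (fun β : ℝ => P₂ β / P₁ β ^ 2) atTop (𝓝 (C₂ / (q * C₁ ^ 2))) := by
    rw [← hval]
    refine hlim.congr' ?_
    filter_upwards [eventually_gt_atTop (0 : ℝ)] with β hβ
    exact (hkey β hβ).symm
  have hdef : ∀ β : ℝ, projSlabDefect ρ β z n (m + 1) (m₂ + 1) (m₃ + 1) = 1 - P₂ β / P₁ β ^ 2 := fun β => rfl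
  have h := (tendsto_const_nhds (x := (1 : ℝ))).sub hratio
  exact h.congr' (Eventually.of_forall fun β => (hdef β).symm)

end Algebra

/-! ## §3 K36's shape for every faithful `r` with a Hessian ratio: the classical limit is the defining representation's -/

section TreeLevel

variable {N : ℕ} [NeZero N] {k : ZMod N}

/-- ★ **K36 FOR `r.ρ` — THE DYNKIN-INDEX RESCALING CANCELS IN THE NUMBER.**  For `N ≥ 2`, `k` a unit, `z = ω^k·1`, `z^n = 1`, `n ≥ 1`,
`ℓ₀ = m+1`, a faithful `r : LatticeRep SU(N)` and `κ > 0` with (Q): with K36's OWN constants `c > 0`, `C ≥ 0` (depending on `N, m` only), for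
every `L = m₂+1`, `t = m₃+1` the limit `D` of `projSlabDefect r.ρ β z n ℓ₀ L t` as `β → ∞` EXISTS, EQUALS the defining representation's
(`1 − κ^{−2a}C₂ ∕ (q·(κ^{−a}C₁)²) = 1 − C₂ ∕ (q·C₁²)`), and `D ≤ C·L·e^{−ct}`. [cite: tHooft1979Flux, §5]
[cite: GarciaperezGonzalezarroyoOkawa2014, §3] -/
theorem treeLevel_uniform_rep (hN : 2 ≤ N) (hk : IsUnit k) {n : ℕ} (hn : 0 < n) (hzn : (suCenter N k : Matrix.specialUnitaryGroup (Fin N) ℂ) ^ n = 1)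
    (r : LatticeRep (Matrix.specialUnitaryGroup (Fin N) ℂ)) {κ : ℝ} (hκ : 0 < κ)
    (hQ : Tendsto (fun h : Matrix.specialUnitaryGroup (Fin N) ℂ =>
      ((r.N : ℝ) - (r.ρ h).trace.re) / ((N : ℝ) - (fundamentalRep (Fin N) h).trace.re)) (𝓝[≠] 1) (𝓝 κ))
    (m : ℕ) :
    ∃ c C : ℝ, 0 < c ∧ 0 ≤ C ∧ ∀ m₂ m₃ : ℕ, ∃ D : ℝ,
      Tendsto (fun β : ℝ => projSlabDefect r.ρ β (suCenter N k : Matrix.specialUnitaryGroup (Fin N) ℂ) n (m + 1) (m₂ + 1) (m₃ + 1)) atTop (𝓝 D) ∧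
        D ≤ C * ((m₂ + 1 : ℕ) : ℝ) * Real.exp (-(c * ((m₃ + 1 : ℕ) : ℝ))) := by
  obtain ⟨c, C, hc, hC, hlim⟩ := twistedSlabAnchor_treeLevel_uniform (N := N) hN hk hn hzn m
  refine ⟨c, C, hc, hC, fun m₂ m₃ => ?_⟩
  obtain ⟨D, hD, hDle⟩ := hlim m₂ m₃
  refine ⟨D, ?_, hDle⟩
  -- the Laplace constants of both boxes, for the defining representation and for `r`
  obtain ⟨C₁, hC₁, hf₁, hr₁⟩ := tendsto_rpow_mul_twistedPartition_slab_rep (m := m) (m₂ := m₂) (m₃ := m₃) hN hk r hκ hQ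
  obtain ⟨C₂, -, hf₂, hr₂⟩ := tendsto_rpow_mul_twistedPartition_slab_rep (m := m) (m₂ := m₂) (m₃ := 2 * m₃ + 1) hN hk r hκ hQ
  -- the projection weights
  obtain ⟨hqf₁, hq⟩ := tendsto_projSlabZ_div_twistedPartition_rep (m₀ := m) (m₂ := m₂) (m₃ := m₃) hk hn
    (continuous_fundamentalRep (Fin N)) fundamentalRep_mem_unitaryGroup (fundamentalRep_injective (Fin N))
  obtain ⟨hqf₂, -⟩ := tendsto_projSlabZ_div_twistedPartition_rep (m₀ := m) (m₂ := m₂) (m₃ := 2 * m₃ + 1) hk hn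
    (continuous_fundamentalRep (Fin N)) fundamentalRep_mem_unitaryGroup (fundamentalRep_injective (Fin N))
  obtain ⟨hqr₁, -⟩ := tendsto_projSlabZ_div_twistedPartition_rep (m₀ := m) (m₂ := m₂) (m₃ := m₃) hk hn
    r.continuous r.mem_unitary r.injective
  obtain ⟨hqr₂, -⟩ := tendsto_projSlabZ_div_twistedPartition_rep (m₀ := m) (m₂ := m₂) (m₃ := 2 * m₃ + 1) hk hn
    r.continuous r.mem_unitary r.injective
  -- the exponent of the doubled box is twice the exponent of the box
  set a : ℝ := ((3 * ((m + 1) * (m + 1) * (m₂ + 1) * (m₃ + 1) * finrank ℝ (specialUnitaryLogChart (Fin N)).lie) : ℕ) / 2 : ℝ) with ha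
  set a₂ : ℝ := ((3 * ((m + 1) * (m + 1) * (m₂ + 1) * (2 * m₃ + 1 + 1) * finrank ℝ (specialUnitaryLogChart (Fin N)).lie) : ℕ) / 2 : ℝ) with ha₂
  have haa : a₂ = 2 * a := by
    simp only [ha, ha₂]
    push_cast
    ring
  -- the defining representation: `D = 1 − C₂/(q C₁²)` by uniqueness of limits
  have hfund := tendsto_projSlabDefect_of_tendsto (continuous_fundamentalRep (Fin N)) haa hC₁ hq hf₁ hf₂ hqf₁ hqf₂
  have hDeq := tendsto_nhds_unique hD hfund
  -- the representation `r`: the same limit, the rescaling cancels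
  have hκa : 0 < κ ^ (-a) * C₁ := mul_pos (Real.rpow_pos_of_pos hκ _) hC₁
  have hrep := tendsto_projSlabDefect_of_tendsto r.continuous haa hκa hq hr₁ hr₂ hqr₁ hqr₂
  have hκ2 : κ ^ (-a₂) = (κ ^ (-a)) ^ 2 := by
    rw [haa, show -(2 * a) = (-a) * 2 by ring, Real.rpow_mul hκ.le, Real.rpow_two]
  have hval : 1 - κ ^ (-a₂) * C₂ / (((n : ℝ)⁻¹ * ((Finset.univ.filter fun j : Fin n => (suCenter N k : Matrix.specialUnitaryGroup (Fin N) ℂ) ^ (j : ℕ) = 1).card : ℝ)) *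
      (κ ^ (-a) * C₁) ^ 2) = D := by
    rw [hDeq, hκ2]
    have hκ0 : κ ^ (-a) ≠ 0 := (Real.rpow_pos_of_pos hκ _).ne'
    field_simp
  rw [← hval]
  exact hrep

end TreeLevel

end Summit.QuantumFields.YangMills.Cruxes.IRcof.TwistedSlab

end
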